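import Summits.QuantumFields.BalabanUV.Beta.CombHId2TorusRecord

/-!
# `BalabanUV.Beta.CombHId2TorusRecordAn1` — binder row D1 (OWNER an2), (J-a) dictionary, (C2) at ORDER 2 AT an1's FOUR-DIMENSIONAL (0.4) RECORD: **ON THE COARSE `ff` BLOCK
# ONLY THE CHAIN SURVIVES** — the order-2 border companion `(cB·wB2)·perF M′(vh₂S^{per,cs})` VANISHES on the `(inl, inl)` entries, so the level-`(j+1)` second-order table's
# coarse `ff` matrix IS `(cE₂·wV4)·` the multiplier entry of the torus polynomial `Â·D̂_b·Â·D̂_{b′}·Â + Â·D̂_{b′}·Â·D̂_b·Â − Â·Ŵ·Â` at the coarse points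

WHY.  The order-2 twin of `CombHId1Door.TV_an1_ff_eq_zero ∕ door_hId1_at_record_an1'` («only the Λ-companion survives»): at the record `tabs := symTablesAn1S2 3 Lc cΛ′` the
second-order border table is the row table `symVh₂SAn1 3 Lc`, which has NO field–field block (`SymSecondOrderTablesAn1.symTablesAn1S2_vh₂S_inl_inl`, by `rfl`) — hence
neither has its copy-summed periodisation.  So the door's `hId₂` on the `ff` block at the 4D record reads the CHAIN ALONE: the order-2 companion `H′₂ − perF M′(T2^{per,cs}_{j+1})`
of N-an2-g44-1 lives on the `fm ∕ mf` blocks only (the slot d1-p3's #36∕#37 display as `E`∕`G`), not on the block `torus_hId₂_iff_graded_comb` equates.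
WHAT ([folklore]; 0 `def`, 0 cited fact, 0 `def … : Prop`, 0 sorry; `d + 1 = 4`): `border₂_an1_inl_inl_eq_zero`; **`perF_dper_tsum_T2comb_succ_inl_inl_an1 (hM) (j) (b b′) (y₁ y₂ m₁ m₂)`**:
`perF M′ (dper M′ (x z ↦ Σ'_n T2_{j+1} b (b′+M′∘n) x z)) ((y₁, inl m₁),(y₂, inl m₂)) = (cE₂·wV4 3 Lc (j+1)) · (Â·D̂_b·Â·D̂_{b′}·Â + Â·D̂_{b′}·Â·D̂_b·Â − Â·Ŵ·Â)((wrapPt M (Lc•y₁), inr m₁),(wrapPt M (Lc•y₂), inr m₂))`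
at `tabs := symTablesAn1S2 3 Lc cΛ′` — `CombHId2TorusRecord.perF_dper_tsum_T2comb_succ_inl_inl` with the border entry rewritten to `0`.  ONE hypothesis `hM : M = Lc·M′`.
NOT HERE: the torus algebra (leaf-05's junction cert); the `fm∕mf` companion's reading; nothing of Bałaban's asserted; NOT D1, NEVER «G-an2-4 closed», NOT BetaPertH, NOT
continuum, NOT Clay.

HONEST DEPENDENCY (page 1, mandatory): continuum YM on T⁴ ⇐ BetaPertH ∧ nine spine estimates (0/9 proved); BetaPertH ⇐ (D1) ∧ (D4) ∧ CAP+tail;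
G-an2-4 gates asym, D1 and NE2/3/4.  HONEST FRAMING (cell contract, verbatim): «discharging `BetaPertH` makes Bałaban's UV stability UNCONDITIONAL —
a real constructive-QFT result; it is NOT the continuum limit and NOT the Clay problem.»  ABSOLUTE RULE (cell charter, verbatim): «No internally-minted
statement may enter as a cited fact. Every hypothesis is either kernel-proved in this package or a verbatim quotation of a PUBLISHED theorem with page
reference. The manuscript(s) under audit are NOT citable for their own disputed steps — they are the thing under adjudication; programme-internal
(2001/route/tribunal) claims are never citable.»  Row D1 OWNER an2 (b2b-balaban-beta-an2) gen 45, 2026-08-23; over `CombHId2TorusRecord` and `SymSecondOrderTablesAn1` BY NAME.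
-/

noncomputable section

open scoped BigOperators Matrix

namespace Summit.QuantumFields.BalabanUV.Beta.CombHId2TorusRecordAn1

open Literature.MathematicalPhysics.QuantumFieldTheory.Balaban1983to89
open Literature.MathematicalPhysics.QuantumFieldTheory.Balaban1983to89.Beta
open B4TorusKernel.MultiPeriod (translate)
open AffineAveraging (Site)
open OneStepResolventKernel (Fib)
open BalabanStepW2 (wV4 wB2 M2Of)
open SecondOrderResponse (dM W2SymOfK)
open Summit.QuantumFields.BalabanUV.Beta.SpineRooted (T2RecOf)
open Summit.QuantumFields.BalabanUV.Beta.FP.KernelPeriodisationFib (perF perZ perF_apply perZ_apply)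
open Summit.QuantumFields.BalabanUV.Beta.FP.KernelPeriodisationFibLoc (dper dper_apply)
open Summit.QuantumFields.BalabanUV.Beta.FP.TorusGaugeCovariancePairing (wrapPt)
open Summit.QuantumFields.BalabanUV.Beta.SymSecondOrderTablesAn1 (symTablesAn1S2 symTablesAn1S2_vh₂S_inl_inl)
open Summit.QuantumFields.BalabanUV.Beta.CombChartStepJets (GcombSh SpureCombOf)
open B6Lemma24Torus (pbox)
open Summit.QuantumFields.BalabanUV.Beta.CombHId2TorusRecord (perF_dper_tsum_T2comb_succ_inl_inl)

variable (M : Fin (3 + 1) → ℕ) [∀ μ, NeZero (M μ)] {Lc : ℕ} [NeZero Lc] {M' : Fin (3 + 1) → ℕ} [∀ μ, NeZero (M' μ)]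
  (cΛ' cE cVH cΛ cE₂ cB : ℝ) (T : Fin 4 → Fin 4 → Fin 4 → Fin 4 → ℝ)

omit [∀ μ, NeZero (M μ)] [∀ μ, NeZero (M' μ)] in
/-- [folklore] at an1's 4D record the second-order border table has no `ff` block (`symTablesAn1S2_vh₂S_inl_inl`), hence the `(inl, inl)` entries of the coarse torus matrix of
its copy-summed periodisation vanish. -/
theorem border₂_an1_inl_inl_eq_zero (μ : Fin (3 + 1)) (y : Site (3 + 1)) (ν : Fin (3 + 1)) (y' : Site (3 + 1)) (y₁ y₂ : ↥(pbox M')) (m₁ m₂ : Fin (3 + 1)) :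
    perF M' (dper M' (fun x z a b => ∑' n, (symTablesAn1S2 3 Lc cΛ').vh₂S μ y ν (translate M' y' n) x z a b)) (y₁, Sum.inl m₁) (y₂, Sum.inl m₂) = 0 := by
  simp only [perF_apply, perZ_apply, dper_apply, symTablesAn1S2_vh₂S_inl_inl, tsum_zero]

/-- [folklore] **THE CROWN AT an1's FOUR-DIMENSIONAL RECORD — ON THE COARSE `ff` BLOCK ONLY THE CHAIN SURVIVES** (`tabs := symTablesAn1S2 3 Lc cΛ′`; `G := GcombSh Lc j`,
`Â := perF M G`, `D̂_b := perF M (dM G Lc S^per_j M^per_j b)`, `Ŵ := perF M (W2SymOfK G Lc S^per_j M^per_j T2^{per,csf}_j M2^{per,cs}_j μ y ν y′)`):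
`perF M′ (dper M′ (x z ↦ Σ'_n T2_{j+1} μ y ν (y′+M′∘n) x z)) ((y₁, inl m₁),(y₂, inl m₂))
 = (cE₂·wV4 3 Lc (j+1)) · (Â·D̂_{μy}·Â·D̂_{νy′}·Â + Â·D̂_{νy′}·Â·D̂_{μy}·Â − Â·Ŵ·Â)((wrapPt M (Lc•y₁), inr m₁),(wrapPt M (Lc•y₂), inr m₂))` — NO border term. -/
theorem perF_dper_tsum_T2comb_succ_inl_inl_an1 (hM : ∀ i, M i = Lc * M' i) (j : ℕ) (μ : Fin (3 + 1)) (y : Site (3 + 1)) (ν : Fin (3 + 1)) (y' : Site (3 + 1))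
    (y₁ y₂ : ↥(pbox M')) (m₁ m₂ : Fin (3 + 1)) :
    perF M' (dper M' (fun x z a b => ∑' n, T2RecOf 3 Lc (GcombSh Lc) (SpureCombOf (symTablesAn1S2 3 Lc cΛ') cE cVH cΛ) (symTablesAn1S2 3 Lc cΛ').M cE₂ cB T
        (symTablesAn1S2 3 Lc cΛ').vh₂S (symTablesAn1S2 3 Lc cΛ').mixFF (j + 1) μ y ν (translate M' y' n) x z a b)) (y₁, Sum.inl m₁) (y₂, Sum.inl m₂)
      = (cE₂ * wV4 3 Lc (j + 1))
          * (perF M (GcombSh (d := 3) Lc j)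
              * perF M (dM (GcombSh (d := 3) Lc j) Lc (fun κ u => dper M (SpureCombOf (symTablesAn1S2 3 Lc cΛ') cE cVH cΛ j κ u))
                  (fun ρ w => dper M ((symTablesAn1S2 3 Lc cΛ').M j ρ w)) μ y)
              * perF M (GcombSh (d := 3) Lc j)
              * perF M (dM (GcombSh (d := 3) Lc j) Lc (fun κ u => dper M (SpureCombOf (symTablesAn1S2 3 Lc cΛ') cE cVH cΛ j κ u))
                  (fun ρ w => dper M ((symTablesAn1S2 3 Lc cΛ').M j ρ w)) ν y')
              * perF M (GcombSh (d := 3) Lc j)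
            + perF M (GcombSh (d := 3) Lc j)
              * perF M (dM (GcombSh (d := 3) Lc j) Lc (fun κ u => dper M (SpureCombOf (symTablesAn1S2 3 Lc cΛ') cE cVH cΛ j κ u))
                  (fun ρ w => dper M ((symTablesAn1S2 3 Lc cΛ').M j ρ w)) ν y')
              * perF M (GcombSh (d := 3) Lc j)
              * perF M (dM (GcombSh (d := 3) Lc j) Lc (fun κ u => dper M (SpureCombOf (symTablesAn1S2 3 Lc cΛ') cE cVH cΛ j κ u))
                  (fun ρ w => dper M ((symTablesAn1S2 3 Lc cΛ').M j ρ w)) μ y)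
              * perF M (GcombSh (d := 3) Lc j)
            - perF M (GcombSh (d := 3) Lc j)
              * perF M (W2SymOfK (GcombSh (d := 3) Lc j) Lc (fun κ u => dper M (SpureCombOf (symTablesAn1S2 3 Lc cΛ') cE cVH cΛ j κ u))
                  (fun ρ w => dper M ((symTablesAn1S2 3 Lc cΛ').M j ρ w))
                  (fun κ u κ' u' => dper M (fun x z a c => ∑' n : Site (3 + 1),
                    T2RecOf 3 Lc (GcombSh Lc) (SpureCombOf (symTablesAn1S2 3 Lc cΛ') cE cVH cΛ) (symTablesAn1S2 3 Lc cΛ').M cE₂ cB T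
                      (symTablesAn1S2 3 Lc cΛ').vh₂S (symTablesAn1S2 3 Lc cΛ').mixFF j κ u κ' (translate M u' n) x z a c))
                  (fun κ u ρ w => dper M (fun x z a c => ∑' n : Site (3 + 1),
                    M2Of 3 Lc (symTablesAn1S2 3 Lc cΛ').mixFF j κ u ρ (translate M' w n) x z a c)) μ y ν y')
              * perF M (GcombSh (d := 3) Lc j))
            (wrapPt M ((Lc : ℤ) • (y₁ : Site (3 + 1))), Sum.inr m₁) (wrapPt M ((Lc : ℤ) • (y₂ : Site (3 + 1))), Sum.inr m₂) := by
  have hB := border₂_an1_inl_inl_eq_zero (M' := M') (Lc := Lc) cΛ' μ y ν y' y₁ y₂ m₁ m₂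
  rw [perF_dper_tsum_T2comb_succ_inl_inl M (symTablesAn1S2 3 Lc cΛ') cE cVH cΛ cE₂ cB T hM j μ y ν y' y₁ y₂ m₁ m₂, hB, mul_zero, add_zero]

end Summit.QuantumFields.BalabanUV.Beta.CombHId2TorusRecordAn1

end
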